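import Literature.MathematicalPhysics.QuantumLattice.SchwartzHalfSpaceCutoff
import Literature.MathematicalPhysics.QuantumLattice.SchwartzHalfSpaceCutoffA
import HarnessLib

/-!
# Smooth half-space cutoffs on multi-point Schwartz functions: smoothness, pointwise form, supports

Trunk **T-AQFT** (companion of `SchwartzHalfSpaceCutoff`, which defines the weights `wLE`, `wGE` and
the cutoff operators `cutLE`, `cutGE` on `𝓢((Fin p → ℝᵈ), ℂ)`), families `constructive-qft`,
`yang-mills`.

* `contDiff_wLE`, `exists_bound_iteratedFDeriv_wLE`, `hasTemperateGrowth_wLE` (and `wGE`, and the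
  complexified weights `x ↦ (wLE crd θ x : ℂ)`, `x ↦ ((1 - wLE crd θ x : ℝ) : ℂ)`): the weights are
  smooth with all derivatives bounded **uniformly in the threshold `θ`** (each factor is a shifted
  smooth step along a coordinate form of norm `≤ 1`, `exists_bound_iteratedFDeriv_prod_smoothTransition`);
* `cutLE_apply : cutLE crd θ F x = wLE crd θ x * F x`, `sub_cutLE_eq_smulLeftCLM` (the remainder
  `F - cutLE crd θ F` is multiplication by `1 - wLE`), `cutLE_apply_of_le` / `cutLE_apply_of_ge`;
* supports: `tsupport (cutLE crd θ F) ⊆ tsupport F ∩ {∀ j, xⱼ[crd] ≤ θ + 1}`,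
  `tsupport (F - cutLE crd θ F) ⊆ tsupport F ∩ {∃ j, θ ≤ xⱼ[crd]}`, and the mirror statements for
  `cutGE` (`≥ θ - 1`, resp. `∃ j, xⱼ[crd] ≤ θ`).

## Sources

Textbook folklore: L. Hörmander, *The Analysis of Linear Partial Differential Operators I*, §7.1;
K. Osterwalder, R. Schrader, *Axioms for Euclidean Green's functions*, CMP 31 (1973), §2.

## Mathlib and Literature

Used from Mathlib: `SchwartzMap.smulLeftCLM_apply_apply`, `SchwartzMap.tsupport_smulLeftCLM_subset`,
`Real.smoothTransition.contDiff`. From the tree: `SchwartzHalfSpaceCutoff` (definitions),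
`SchwartzHalfSpaceCutoffA` (`exists_bound_iteratedFDeriv_prod_smoothTransition`,
`norm_iteratedFDeriv_one_sub_le`, `contDiff_complex_ofReal_comp`,
`norm_iteratedFDeriv_complex_ofReal_comp`), `SchwartzPartition` (`hasTemperateGrowth_of_bounds`).

## Build note

Expected tree imports: Literature.MathematicalPhysics.QuantumLattice.SchwartzHalfSpaceCutoff (landed p110643); Literature.MathematicalPhysics.QuantumLattice.SchwartzHalfSpaceCutoffA (landed p110638).
This file was validated by elaborating the concatenation of the four parts
(`SchwartzHalfSpaceCutoff` + `A` + `B` + `C`, identical declarations, rc 0, no warnings) against the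
tree while the Lean farm build of the freshly landed imports was still pending.
-/

set_option autoImplicit false

open scoped SchwartzMap Topology ContDiff
open Filter Set

noncomputable section

namespace Literature.MathematicalPhysics.QuantumLattice

/-! ### Smoothness and uniform derivative bounds of the weights -/

section HalfSpaceWeights

variable {d p : ℕ} (crd : Fin d) (θ : ℝ)


/-- `wLE` as a product of shifted smooth steps along the linear forms `-coordCLM`. [folklore] -/
theorem wLE_eq_prod_coordCLM : (wLE crd θ : (Fin p → EuclideanSpace ℝ (Fin d)) → ℝ) =
    fun x => ∏ j, Real.smoothTransition ((-coordCLM crd j) x + (θ + 1)) := by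
  funext x
  simp only [wLE, neg_apply, coordCLM_apply]
  exact Finset.prod_congr rfl fun j _ => by ring_nf

/-- `wGE` as a product of shifted smooth steps along the linear forms `coordCLM`. [folklore] -/
theorem wGE_eq_prod_coordCLM : (wGE crd θ : (Fin p → EuclideanSpace ℝ (Fin d)) → ℝ) =
    fun x => ∏ j, Real.smoothTransition ((coordCLM crd j) x + (1 - θ)) := by
  funext x
  simp only [wGE, coordCLM_apply]
  exact Finset.prod_congr rfl fun j _ => by ring_nf

/-- `wLE` is smooth. [folklore] -/
theorem contDiff_wLE {m : ℕ∞} : ContDiff ℝ m (wLE crd θ : (Fin p → EuclideanSpace ℝ (Fin d)) → ℝ) :=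
  contDiff_prod fun j _ => Real.smoothTransition.contDiff.comp
    (contDiff_const.sub (contDiff_coord j crd))

/-- `wGE` is smooth. [folklore] -/
theorem contDiff_wGE {m : ℕ∞} : ContDiff ℝ m (wGE crd θ : (Fin p → EuclideanSpace ℝ (Fin d)) → ℝ) :=
  contDiff_prod fun j _ => Real.smoothTransition.contDiff.comp
    (((contDiff_coord j crd).sub contDiff_const).add contDiff_const)

/-- **The derivatives of `wLE crd θ` are bounded uniformly in `θ`** (each factor is a shifted smooth
step along a linear form of norm `≤ 1`) (Hörmander, ALPDO I §7.1; Osterwalder–Schrader 1973 §2). [folklore] -/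
theorem exists_bound_iteratedFDeriv_wLE (i : ℕ) :
    ∃ C : ℝ, ∀ (θ : ℝ) (x : Fin p → EuclideanSpace ℝ (Fin d)),
      ‖iteratedFDeriv ℝ i (wLE crd θ) x‖ ≤ C := by
  obtain ⟨C, hC⟩ := exists_bound_iteratedFDeriv_prod_smoothTransition
    (V := Fin p → EuclideanSpace ℝ (Fin d)) p i
  refine ⟨C, fun θ' x => ?_⟩
  rw [wLE_eq_prod_coordCLM]
  exact hC (fun j => -coordCLM crd j) (fun j => by rw [norm_neg]; exact norm_coordCLM_le_one crd j)
    (fun _ => θ' + 1) x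

/-- **The derivatives of `wGE crd θ` are bounded uniformly in `θ`.** (Hörmander, ALPDO I §7.1;
Osterwalder–Schrader 1973 §2). [folklore] -/
theorem exists_bound_iteratedFDeriv_wGE (i : ℕ) :
    ∃ C : ℝ, ∀ (θ : ℝ) (x : Fin p → EuclideanSpace ℝ (Fin d)),
      ‖iteratedFDeriv ℝ i (wGE crd θ) x‖ ≤ C := by
  obtain ⟨C, hC⟩ := exists_bound_iteratedFDeriv_prod_smoothTransition
    (V := Fin p → EuclideanSpace ℝ (Fin d)) p i
  refine ⟨C, fun θ' x => ?_⟩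
  rw [wGE_eq_prod_coordCLM]
  exact hC (fun j => coordCLM crd j) (fun j => norm_coordCLM_le_one crd j) (fun _ => 1 - θ') x

/-- The lower weight has temperate growth (all derivatives are bounded). [folklore] -/
theorem hasTemperateGrowth_wLE :
    (wLE crd θ : (Fin p → EuclideanSpace ℝ (Fin d)) → ℝ).HasTemperateGrowth := by
  have h := fun i => exists_bound_iteratedFDeriv_wLE (p := p) crd i
  choose A hA using h
  exact hasTemperateGrowth_of_bounds (contDiff_wLE crd θ) A fun j x => hA j θ x

/-- The upper weight has temperate growth (all derivatives are bounded). [folklore] -/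
theorem hasTemperateGrowth_wGE :
    (wGE crd θ : (Fin p → EuclideanSpace ℝ (Fin d)) → ℝ).HasTemperateGrowth := by
  have h := fun i => exists_bound_iteratedFDeriv_wGE (p := p) crd i
  choose A hA using h
  exact hasTemperateGrowth_of_bounds (contDiff_wGE crd θ) A fun j x => hA j θ x

/-! ### Complexified weights -/

/-- The complexified lower weight is smooth. [folklore] -/
theorem contDiff_ofReal_wLE :
    ContDiff ℝ ∞ fun x : Fin p → EuclideanSpace ℝ (Fin d) => (wLE crd θ x : ℂ) :=
  contDiff_complex_ofReal_comp (contDiff_wLE crd θ)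

/-- The complexified upper weight is smooth. [folklore] -/
theorem contDiff_ofReal_wGE :
    ContDiff ℝ ∞ fun x : Fin p → EuclideanSpace ℝ (Fin d) => (wGE crd θ x : ℂ) :=
  contDiff_complex_ofReal_comp (contDiff_wGE crd θ)

/-- The complexified complementary lower weight `1 - wLE` is smooth. [folklore] -/
theorem contDiff_ofReal_one_sub_wLE :
    ContDiff ℝ ∞ fun x : Fin p → EuclideanSpace ℝ (Fin d) => ((1 - wLE crd θ x : ℝ) : ℂ) :=
  contDiff_complex_ofReal_comp (contDiff_const.sub (contDiff_wLE crd θ))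

/-- The complexified complementary upper weight `1 - wGE` is smooth. [folklore] -/
theorem contDiff_ofReal_one_sub_wGE :
    ContDiff ℝ ∞ fun x : Fin p → EuclideanSpace ℝ (Fin d) => ((1 - wGE crd θ x : ℝ) : ℂ) :=
  contDiff_complex_ofReal_comp (contDiff_const.sub (contDiff_wGE crd θ))

/-- **Uniform bounds for the complexified lower weight**: a sequence `A` with
`‖Dⁱ (wLE crd θ : ℂ)‖ ≤ Aᵢ` for all `θ`. [folklore] -/
theorem exists_seq_bound_iteratedFDeriv_ofReal_wLE :
    ∃ A : ℕ → ℝ, ∀ (i : ℕ) (θ : ℝ) (x : Fin p → EuclideanSpace ℝ (Fin d)),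
      ‖iteratedFDeriv ℝ i (fun y : Fin p → EuclideanSpace ℝ (Fin d) => (wLE crd θ y : ℂ)) x‖ ≤ A i := by
  have h := fun i => exists_bound_iteratedFDeriv_wLE (p := p) crd i
  choose A hA using h
  refine ⟨A, fun i θ' x => ?_⟩
  rw [norm_iteratedFDeriv_complex_ofReal_comp (contDiff_wLE crd θ')]
  exact hA i θ' x

/-- **Uniform bounds for the complexified upper weight.** [folklore] -/
theorem exists_seq_bound_iteratedFDeriv_ofReal_wGE :
    ∃ A : ℕ → ℝ, ∀ (i : ℕ) (θ : ℝ) (x : Fin p → EuclideanSpace ℝ (Fin d)),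
      ‖iteratedFDeriv ℝ i (fun y : Fin p → EuclideanSpace ℝ (Fin d) => (wGE crd θ y : ℂ)) x‖ ≤ A i := by
  have h := fun i => exists_bound_iteratedFDeriv_wGE (p := p) crd i
  choose A hA using h
  refine ⟨A, fun i θ' x => ?_⟩
  rw [norm_iteratedFDeriv_complex_ofReal_comp (contDiff_wGE crd θ')]
  exact hA i θ' x

/-- **Uniform bounds for the complexified complementary lower weight `1 - wLE`.** [folklore] -/
theorem exists_seq_bound_iteratedFDeriv_ofReal_one_sub_wLE :
    ∃ A : ℕ → ℝ, ∀ (i : ℕ) (θ : ℝ) (x : Fin p → EuclideanSpace ℝ (Fin d)),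
      ‖iteratedFDeriv ℝ i (fun y : Fin p → EuclideanSpace ℝ (Fin d) =>
        ((1 - wLE crd θ y : ℝ) : ℂ)) x‖ ≤ A i := by
  have h := fun i => exists_bound_iteratedFDeriv_wLE (p := p) crd i
  choose A hA using h
  refine ⟨fun i => A i + 1, fun i θ' x => ?_⟩
  rw [norm_iteratedFDeriv_complex_ofReal_comp (contDiff_const.sub (contDiff_wLE crd θ'))]
  exact norm_iteratedFDeriv_one_sub_le (contDiff_wLE crd θ') (fun j y => hA j θ' y) i x

/-- **Uniform bounds for the complexified complementary upper weight `1 - wGE`.** [folklore] -/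
theorem exists_seq_bound_iteratedFDeriv_ofReal_one_sub_wGE :
    ∃ A : ℕ → ℝ, ∀ (i : ℕ) (θ : ℝ) (x : Fin p → EuclideanSpace ℝ (Fin d)),
      ‖iteratedFDeriv ℝ i (fun y : Fin p → EuclideanSpace ℝ (Fin d) =>
        ((1 - wGE crd θ y : ℝ) : ℂ)) x‖ ≤ A i := by
  have h := fun i => exists_bound_iteratedFDeriv_wGE (p := p) crd i
  choose A hA using h
  refine ⟨fun i => A i + 1, fun i θ' x => ?_⟩
  rw [norm_iteratedFDeriv_complex_ofReal_comp (contDiff_const.sub (contDiff_wGE crd θ'))]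
  exact norm_iteratedFDeriv_one_sub_le (contDiff_wGE crd θ') (fun j y => hA j θ' y) i x

/-- The complexified lower weight has temperate growth. [folklore] -/
theorem hasTemperateGrowth_ofReal_wLE :
    (fun x : Fin p → EuclideanSpace ℝ (Fin d) => (wLE crd θ x : ℂ)).HasTemperateGrowth := by
  obtain ⟨A, hA⟩ := exists_seq_bound_iteratedFDeriv_ofReal_wLE (p := p) crd
  exact hasTemperateGrowth_of_bounds (contDiff_ofReal_wLE crd θ) A fun j x => hA j θ x

/-- The complexified upper weight has temperate growth. [folklore] -/
theorem hasTemperateGrowth_ofReal_wGE :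
    (fun x : Fin p → EuclideanSpace ℝ (Fin d) => (wGE crd θ x : ℂ)).HasTemperateGrowth := by
  obtain ⟨A, hA⟩ := exists_seq_bound_iteratedFDeriv_ofReal_wGE (p := p) crd
  exact hasTemperateGrowth_of_bounds (contDiff_ofReal_wGE crd θ) A fun j x => hA j θ x

/-- The complexified complementary lower weight has temperate growth. [folklore] -/
theorem hasTemperateGrowth_ofReal_one_sub_wLE :
    (fun x : Fin p → EuclideanSpace ℝ (Fin d) => ((1 - wLE crd θ x : ℝ) : ℂ)).HasTemperateGrowth := by
  obtain ⟨A, hA⟩ := exists_seq_bound_iteratedFDeriv_ofReal_one_sub_wLE (p := p) crd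
  exact hasTemperateGrowth_of_bounds (contDiff_ofReal_one_sub_wLE crd θ) A fun j x => hA j θ x

/-- The complexified complementary upper weight has temperate growth. [folklore] -/
theorem hasTemperateGrowth_ofReal_one_sub_wGE :
    (fun x : Fin p → EuclideanSpace ℝ (Fin d) => ((1 - wGE crd θ x : ℝ) : ℂ)).HasTemperateGrowth := by
  obtain ⟨A, hA⟩ := exists_seq_bound_iteratedFDeriv_ofReal_one_sub_wGE (p := p) crd
  exact hasTemperateGrowth_of_bounds (contDiff_ofReal_one_sub_wGE crd θ) A fun j x => hA j θ x

/-! ### Pointwise form of the cutoff operators -/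

/-- `cutLE crd θ F x = wLE crd θ x * F x`. [folklore] -/
@[simp]
theorem cutLE_apply (F : 𝓢((Fin p → EuclideanSpace ℝ (Fin d)), ℂ)) (x : Fin p → EuclideanSpace ℝ (Fin d)) :
    cutLE crd θ F x = (wLE crd θ x : ℂ) * F x := by
  rw [cutLE, SchwartzMap.smulLeftCLM_apply_apply (hasTemperateGrowth_ofReal_wLE crd θ), smul_eq_mul]

/-- `cutGE crd θ F x = wGE crd θ x * F x`. [folklore] -/
@[simp]
theorem cutGE_apply (F : 𝓢((Fin p → EuclideanSpace ℝ (Fin d)), ℂ)) (x : Fin p → EuclideanSpace ℝ (Fin d)) :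
    cutGE crd θ F x = (wGE crd θ x : ℂ) * F x := by
  rw [cutGE, SchwartzMap.smulLeftCLM_apply_apply (hasTemperateGrowth_ofReal_wGE crd θ), smul_eq_mul]

/-- `(F - cutLE crd θ F) x = (1 - wLE crd θ x) * F x`. [folklore] -/
theorem sub_cutLE_apply (F : 𝓢((Fin p → EuclideanSpace ℝ (Fin d)), ℂ))
    (x : Fin p → EuclideanSpace ℝ (Fin d)) :
    (F - cutLE crd θ F) x = ((1 - wLE crd θ x : ℝ) : ℂ) * F x := by
  rw [sub_apply, cutLE_apply]
  push_cast
  ring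

/-- `(F - cutGE crd θ F) x = (1 - wGE crd θ x) * F x`. [folklore] -/
theorem sub_cutGE_apply (F : 𝓢((Fin p → EuclideanSpace ℝ (Fin d)), ℂ))
    (x : Fin p → EuclideanSpace ℝ (Fin d)) :
    (F - cutGE crd θ F) x = ((1 - wGE crd θ x : ℝ) : ℂ) * F x := by
  rw [sub_apply, cutGE_apply]
  push_cast
  ring

/-- `F - cutLE crd θ F` is multiplication by the complementary weight `1 - wLE crd θ`. [folklore] -/
theorem sub_cutLE_eq_smulLeftCLM (F : 𝓢((Fin p → EuclideanSpace ℝ (Fin d)), ℂ)) :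
    F - cutLE crd θ F = SchwartzMap.smulLeftCLM ℂ
      (fun x : Fin p → EuclideanSpace ℝ (Fin d) => ((1 - wLE crd θ x : ℝ) : ℂ)) F := by
  ext x
  rw [sub_cutLE_apply, SchwartzMap.smulLeftCLM_apply_apply
    (hasTemperateGrowth_ofReal_one_sub_wLE crd θ), smul_eq_mul]

/-- `F - cutGE crd θ F` is multiplication by the complementary weight `1 - wGE crd θ`. [folklore] -/
theorem sub_cutGE_eq_smulLeftCLM (F : 𝓢((Fin p → EuclideanSpace ℝ (Fin d)), ℂ)) :
    F - cutGE crd θ F = SchwartzMap.smulLeftCLM ℂ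
      (fun x : Fin p → EuclideanSpace ℝ (Fin d) => ((1 - wGE crd θ x : ℝ) : ℂ)) F := by
  ext x
  rw [sub_cutGE_apply, SchwartzMap.smulLeftCLM_apply_apply
    (hasTemperateGrowth_ofReal_one_sub_wGE crd θ), smul_eq_mul]

variable {crd θ}

/-- Below the threshold the lower cutoff does nothing: `cutLE crd θ F x = F x` if all `xⱼ[crd] ≤ θ`.
[folklore] -/
theorem cutLE_apply_of_le (F : 𝓢((Fin p → EuclideanSpace ℝ (Fin d)), ℂ))
    {x : Fin p → EuclideanSpace ℝ (Fin d)} (h : ∀ j, x j crd ≤ θ) : cutLE crd θ F x = F x := by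
  rw [cutLE_apply, wLE_eq_one h, Complex.ofReal_one, one_mul]

/-- Above `θ + 1` in some point the lower cutoff kills: `cutLE crd θ F x = 0` if some
`xⱼ[crd] ≥ θ + 1`. [folklore] -/
theorem cutLE_apply_of_ge (F : 𝓢((Fin p → EuclideanSpace ℝ (Fin d)), ℂ))
    {x : Fin p → EuclideanSpace ℝ (Fin d)} {j : Fin p} (h : θ + 1 ≤ x j crd) : cutLE crd θ F x = 0 := by
  rw [cutLE_apply, wLE_eq_zero h, Complex.ofReal_zero, zero_mul]

/-- Above the threshold the upper cutoff does nothing: `cutGE crd θ F x = F x` if all `xⱼ[crd] ≥ θ`.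
[folklore] -/
theorem cutGE_apply_of_ge (F : 𝓢((Fin p → EuclideanSpace ℝ (Fin d)), ℂ))
    {x : Fin p → EuclideanSpace ℝ (Fin d)} (h : ∀ j, θ ≤ x j crd) : cutGE crd θ F x = F x := by
  rw [cutGE_apply, wGE_eq_one h, Complex.ofReal_one, one_mul]

/-- Below `θ - 1` in some point the upper cutoff kills: `cutGE crd θ F x = 0` if some
`xⱼ[crd] ≤ θ - 1`. [folklore] -/
theorem cutGE_apply_of_le (F : 𝓢((Fin p → EuclideanSpace ℝ (Fin d)), ℂ))
    {x : Fin p → EuclideanSpace ℝ (Fin d)} {j : Fin p} (h : x j crd ≤ θ - 1) : cutGE crd θ F x = 0 := by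
  rw [cutGE_apply, wGE_eq_zero h, Complex.ofReal_zero, zero_mul]

/-! ### Supports -/

variable (crd θ)


/-- **Support of the lower cutoff**: `supp (cutLE crd θ F) ⊆ supp F ∩ {x | ∀ j, xⱼ[crd] ≤ θ + 1}`
(Osterwalder–Schrader 1973 §2). [folklore] -/
theorem tsupport_cutLE_subset (F : 𝓢((Fin p → EuclideanSpace ℝ (Fin d)), ℂ)) :
    tsupport (cutLE crd θ F : (Fin p → EuclideanSpace ℝ (Fin d)) → ℂ) ⊆
      tsupport (F : (Fin p → EuclideanSpace ℝ (Fin d)) → ℂ) ∩ {x | ∀ j, x j crd ≤ θ + 1} := by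
  refine (SchwartzMap.tsupport_smulLeftCLM_subset _ F).trans (inter_subset_inter_right _ ?_)
  have hcl : IsClosed {x : Fin p → EuclideanSpace ℝ (Fin d) | ∀ j, x j crd ≤ θ + 1} := by
    simp only [setOf_forall]
    exact isClosed_iInter fun j => isClosed_le (contDiff_coord j crd (m := 0)).continuous
      continuous_const
  refine closure_minimal (fun x hx j => ?_) hcl
  by_contra h
  exact hx (by simp [wLE_eq_zero (le_of_not_ge h)])

/-- **Support of the lower remainder**: `supp (F - cutLE crd θ F) ⊆ supp F ∩ {x | ∃ j, θ ≤ xⱼ[crd]}`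
(Osterwalder–Schrader 1973 §2). [folklore] -/
theorem tsupport_sub_cutLE_subset (F : 𝓢((Fin p → EuclideanSpace ℝ (Fin d)), ℂ)) :
    tsupport ((F - cutLE crd θ F : 𝓢((Fin p → EuclideanSpace ℝ (Fin d)), ℂ)) :
        (Fin p → EuclideanSpace ℝ (Fin d)) → ℂ) ⊆
      tsupport (F : (Fin p → EuclideanSpace ℝ (Fin d)) → ℂ) ∩ {x | ∃ j, θ ≤ x j crd} := by
  rw [sub_cutLE_eq_smulLeftCLM]
  refine (SchwartzMap.tsupport_smulLeftCLM_subset _ F).trans (inter_subset_inter_right _ ?_)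
  have hcl : IsClosed {x : Fin p → EuclideanSpace ℝ (Fin d) | ∃ j, θ ≤ x j crd} := by
    simp only [setOf_exists]
    exact isClosed_iUnion_of_finite fun j => isClosed_le continuous_const
      (contDiff_coord j crd (m := 0)).continuous
  refine closure_minimal (fun x hx => ?_) hcl
  by_contra h
  simp only [mem_setOf_eq, not_exists, not_le] at h
  exact hx (by simp [wLE_eq_one fun j => (h j).le])

/-- **Support of the upper cutoff**: `supp (cutGE crd θ F) ⊆ supp F ∩ {x | ∀ j, θ - 1 ≤ xⱼ[crd]}`
(Osterwalder–Schrader 1973 §2). [folklore] -/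
theorem tsupport_cutGE_subset (F : 𝓢((Fin p → EuclideanSpace ℝ (Fin d)), ℂ)) :
    tsupport (cutGE crd θ F : (Fin p → EuclideanSpace ℝ (Fin d)) → ℂ) ⊆
      tsupport (F : (Fin p → EuclideanSpace ℝ (Fin d)) → ℂ) ∩ {x | ∀ j, θ - 1 ≤ x j crd} := by
  refine (SchwartzMap.tsupport_smulLeftCLM_subset _ F).trans (inter_subset_inter_right _ ?_)
  have hcl : IsClosed {x : Fin p → EuclideanSpace ℝ (Fin d) | ∀ j, θ - 1 ≤ x j crd} := by
    simp only [setOf_forall]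
    exact isClosed_iInter fun j => isClosed_le continuous_const
      (contDiff_coord j crd (m := 0)).continuous
  refine closure_minimal (fun x hx j => ?_) hcl
  by_contra h
  exact hx (by simp [wGE_eq_zero (le_of_not_ge h)])

/-- **Support of the upper remainder**: `supp (F - cutGE crd θ F) ⊆ supp F ∩ {x | ∃ j, xⱼ[crd] ≤ θ}`
(Osterwalder–Schrader 1973 §2). [folklore] -/
theorem tsupport_sub_cutGE_subset (F : 𝓢((Fin p → EuclideanSpace ℝ (Fin d)), ℂ)) :
    tsupport ((F - cutGE crd θ F : 𝓢((Fin p → EuclideanSpace ℝ (Fin d)), ℂ)) :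
        (Fin p → EuclideanSpace ℝ (Fin d)) → ℂ) ⊆
      tsupport (F : (Fin p → EuclideanSpace ℝ (Fin d)) → ℂ) ∩ {x | ∃ j, x j crd ≤ θ} := by
  rw [sub_cutGE_eq_smulLeftCLM]
  refine (SchwartzMap.tsupport_smulLeftCLM_subset _ F).trans (inter_subset_inter_right _ ?_)
  have hcl : IsClosed {x : Fin p → EuclideanSpace ℝ (Fin d) | ∃ j, x j crd ≤ θ} := by
    simp only [setOf_exists]
    exact isClosed_iUnion_of_finite fun j => isClosed_le
      (contDiff_coord j crd (m := 0)).continuous continuous_const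
  refine closure_minimal (fun x hx => ?_) hcl
  by_contra h
  simp only [mem_setOf_eq, not_exists, not_le] at h
  exact hx (by simp [wGE_eq_one fun j => (h j).le])
end HalfSpaceWeights

end Literature.MathematicalPhysics.QuantumLattice
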